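import Literature.NumberTheory.GaloisRepresentations.NumberFieldCdTwoProofs
import Literature.NumberTheory.GaloisRepresentations.GaloisCohomologyCorestriction
import Literature.NumberTheory.GaloisRepresentations.ArtinRestriction
import Literature.NumberTheory.GaloisRepresentations.AbsGaloisInvolutionsRealPlacePerm
import Literature.NumberTheory.GaloisRepresentations.CohomologicalDimension
import HarnessLib

/-!
# `cd₂(ker ρ) ≤ 2` for a finite Galois module over `ℚ` moved by an involution
# (K4 `SignedControlAtTwo`, archimedean row at the consumed module `E[2]`, kernel step)

Crux K4 `SignedControlAtTwo` (stmt-BirchSwinnertonDyer-20309; routes `ThetaPartnerAtTwo` / `ResidualThetaTransportAtTwo`),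
line `eulerchar` v12; width seat `bsd-wall-tp2-p3-w3` g8 (`--supports stmt-BirchSwinnertonDyer-20309`, helper).

Let `M` be a finite discrete `Γ_ℚ`-module (`DiscreteGaloisModule ℚ M`) with kernel `N = ker(Γ_ℚ → Aut M)` (open, normal) and
splitting field `L = ℚ̄^N = ℚ(M)`.  **If some involution `τ ∈ Γ_ℚ` (`τ² = 1`) acts non-trivially on `M`, then `L` is totally
complex and `cd₂(N) ≤ 2`** (`groupCdLE_two_ker_of_involution_moves`).  Proof:
* every non-trivial involution of `Γ_ℚ` is a complex conjugation (Artin–Schreier, the tree's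
  `exists_isComplexConjugationAt_of_sq_eq_one`), `ℚ` has ONE infinite place, and two complex conjugations at the same place
  are conjugate (`IsComplexConjugation.isConj`): so every non-trivial involution of `Γ_ℚ` is conjugate to `τ`, hence acts
  non-trivially on `M` (`N` is normal), hence does not lie in `N = Gal(ℚ̄/L)`;
* a real place of `L` would give a complex conjugation `c ∈ Γ_L` (`exists_isComplexConjugation`) whose image in `Γ_ℚ` is a
  non-trivial involution inside `res(Γ_L) = N` (Krull correspondence, `exists_mem_range_absGaloisRestrict_fixedField_iff`) —
  contradiction; so `L` is totally complex (`isTotallyComplex_fixedField_ker`);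
* `cd₂(Γ_L) ≤ 2` for totally complex `L` (Serre II §4.4 Prop. 13, the tree's THEOREM `fieldCdLE_two_of_numberField_holds`), and
  `Γ_L ≃ₜ* res(Γ_L) = N` (`absGaloisRangeEquiv`) transports it to `N` (`GroupCdLE.of_continuousMulEquiv`).

Consumer: with `M = E[2]` for `E/ℚ` on the K4 row and `τ` the complex conjugation at the real place (which moves `E[2]` iff
`Δ(E) < 0`), this is the `cd₂` input of `SignedEC.KleinFour.subsingleton_H_three_of_kleinFour`, giving `H³(ℚ, E[2]) = 0` — the
instance of Milne *ADT* I Thm. 4.10 (c) (`stub_poitouTateThreeRealRat`) that the line consumes.  HONEST FRAMING: THEOREMS only;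
no definition, no named fact, no instance, no `sorry`; nothing about any curve is asserted
here; closes no item; BSD is not proved by any of this.

References: [SerreGaloisCohomology1997] II §4.4 Prop. 13; [NeukirchANT1999] Ch. IV §1 (Krull correspondence);
[ArtinSchreier1927Kennzeichnung] Satz 4; [MilneADT2006] I Thm. 4.10 (c).
-/

set_option autoImplicit false
-- the Theorems namespace of this sub repeats the summit name by design (D-0017 nested layout)
set_option linter.dupNamespace false

noncomputable section

namespace Summit.BirchSwinnertonDyer.BirchSwinnertonDyer.Theorems.SignedEC.ArchMoves

open Field NumberField Literature.NumberTheory.GaloisRepresentations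

variable {M : Type} [AddCommGroup M] [TopologicalSpace M] [DiscreteTopology M]

/-- Membership in the kernel of a Galois module, pointwise. [folklore] -/
theorem mem_ker_iff_forall (ρ : DiscreteGaloisModule ℚ M) (g : absoluteGaloisGroup ℚ) :
    g ∈ ρ.ker ↔ ∀ m, ρ g m = m := by
  rw [ContinuousRep.mem_ker, LinearMap.ext_iff]
  rfl

/-- The kernel of the action on a FINITE discrete module is open (finite intersection of open stabilisers,
Serre I §2.1). [cite: SerreGaloisCohomology1997, I §2.1] -/
theorem isOpen_ker [Finite M] (ρ : DiscreteGaloisModule ℚ M) : IsOpen (ρ.ker : Set (absoluteGaloisGroup ℚ)) := by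
  have : (ρ.ker : Set (absoluteGaloisGroup ℚ)) = ⋂ m : M, {g | ρ g m = m} := by
    ext g
    simp only [SetLike.mem_coe, mem_ker_iff_forall, Set.mem_iInter, Set.mem_setOf_eq]
  rw [this]
  exact isOpen_iInter_of_finite fun m => ρ.isOpen_setOf_apply_eq m

/-- The kernel of a Galois module is a normal subgroup. [folklore] -/
theorem ker_normal (ρ : DiscreteGaloisModule ℚ M) : ρ.ker.Normal :=
  MonoidHom.normal_ker ρ.toRepresentation

/-- **Every non-trivial involution of `Γ_ℚ` is conjugate to any other** (Artin–Schreier: both are complex conjugations;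
`ℚ` has one infinite place; conjugations at the same place are conjugate).
[cite: ArtinSchreier1927Kennzeichnung, Satz 4] -/
theorem isConj_of_sq_eq_one {τ τ' : absoluteGaloisGroup ℚ} (h1 : τ ≠ 1) (h2 : τ ^ 2 = 1) (h1' : τ' ≠ 1)
    (h2' : τ' ^ 2 = 1) : IsConj τ τ' := by
  obtain ⟨w, hw, hτ⟩ := exists_isComplexConjugationAt_of_sq_eq_one τ h1 h2
  obtain ⟨w', hw', hτ'⟩ := exists_isComplexConjugationAt_of_sq_eq_one τ' h1' h2'
  obtain rfl : w = w' := Subsingleton.elim _ _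
  exact IsComplexConjugation.isConj hτ hτ'

/-- **An involution moving `M` forces every non-trivial involution out of the kernel**: if `τ² = 1` and `τ m ≠ m` for some
`m`, then no `τ' ≠ 1` with `τ'² = 1` acts trivially on `M` (it is conjugate to `τ`, and `ker ρ` is normal).
[cite: ArtinSchreier1927Kennzeichnung, Satz 4] -/
theorem not_mem_ker_of_sq_eq_one (ρ : DiscreteGaloisModule ℚ M) {τ : absoluteGaloisGroup ℚ} (h2 : τ ^ 2 = 1)
    (hτ : ∃ m, ρ τ m ≠ m) {τ' : absoluteGaloisGroup ℚ} (h1' : τ' ≠ 1) (h2' : τ' ^ 2 = 1) : τ' ∉ ρ.ker := by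
  obtain ⟨m, hm⟩ := hτ
  have h1 : τ ≠ 1 := by
    rintro rfl
    exact hm (by rw [map_one, Module.End.one_apply])
  intro hτ'
  obtain ⟨u, hu⟩ := isConj_of_sq_eq_one h1' h2' h1 h2
  -- `u τ' u⁻¹ = τ`
  have hτeq : τ = (u : absoluteGaloisGroup ℚ) * τ' * (u : absoluteGaloisGroup ℚ)⁻¹ := by
    rw [hu.eq, mul_inv_cancel_right]
  have hτker : τ ∈ ρ.ker := by
    rw [hτeq]
    exact (ker_normal ρ).conj_mem τ' hτ' _
  exact hm ((mem_ker_iff_forall ρ τ).1 hτker m)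

section Kernel

variable [Finite M] (ρ : DiscreteGaloisModule ℚ M)

/-- **The image of `Γ_{ℚ(M)} → Γ_ℚ` is the kernel** `N = ker ρ` (`ℚ(M) = ℚ̄^N`; Krull correspondence + normality of `N`).
[cite: NeukirchANT1999, Ch. IV §1] -/
theorem range_absGaloisRestrict_fixedField_ker :
    (absGaloisRestrict ℚ (IntermediateField.fixedField ρ.ker : IntermediateField ℚ (AlgebraicClosure ℚ))).range = ρ.ker := by
  obtain ⟨g, hg⟩ := exists_mem_range_absGaloisRestrict_fixedField_iff ρ.ker (isOpen_ker ρ)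
  ext γ
  refine (hg γ).trans ⟨fun h => ?_, fun h => ?_⟩
  · have := (ker_normal ρ).conj_mem _ h g
    rwa [← mul_assoc, ← mul_assoc, mul_inv_cancel, one_mul, mul_inv_cancel_right] at this
  · have := (ker_normal ρ).conj_mem _ h g⁻¹
    rwa [inv_inv] at this

/-- **`ℚ(M)` is totally complex when an involution moves `M`.** [cite: ArtinSchreier1927Kennzeichnung, Satz 4] -/
theorem isTotallyComplex_fixedField_ker {τ : absoluteGaloisGroup ℚ} (h2 : τ ^ 2 = 1) (hτ : ∃ m, ρ τ m ≠ m) :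
    IsTotallyComplex (IntermediateField.fixedField ρ.ker : IntermediateField ℚ (AlgebraicClosure ℚ)) := by
  set L : IntermediateField ℚ (AlgebraicClosure ℚ) := IntermediateField.fixedField ρ.ker with hL
  haveI : FiniteDimensional ℚ L := finiteDimensional_fixedField_of_isOpen ρ.ker (isOpen_ker ρ)
  haveI : Algebra.IsAlgebraic ℚ L := Algebra.IsAlgebraic.of_finite ℚ L
  refine ⟨fun v => ?_⟩
  by_contra hv
  rw [InfinitePlace.not_isComplex_iff_isReal] at hv
  obtain ⟨c, hc⟩ := exists_isComplexConjugation (InfinitePlace.embedding_of_isReal hv)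
  have h1' : absGaloisRestrict ℚ L c ≠ 1 := fun h =>
    hc.ne_one (absGaloisRestrict_injective ℚ L (by rw [h, map_one]))
  have h2' : absGaloisRestrict ℚ L c ^ 2 = 1 := by rw [← map_pow, hc.sq_eq_one, map_one]
  have hmem : absGaloisRestrict ℚ L c ∈ ρ.ker := by
    rw [← range_absGaloisRestrict_fixedField_ker ρ]
    exact ⟨c, rfl⟩
  exact not_mem_ker_of_sq_eq_one ρ h2 hτ h1' h2' hmem

/-- **`cd₂(ker ρ) ≤ 2` when an involution of `Γ_ℚ` moves the finite module `M`**: `ℚ(M)` is totally complex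
(`isTotallyComplex_fixedField_ker`), so `cd₂(Γ_{ℚ(M)}) ≤ 2` by Serre II §4.4 Prop. 13 (tree theorem
`fieldCdLE_two_of_numberField_holds`), transported along `Γ_{ℚ(M)} ≃ₜ* N`. [cite: SerreGaloisCohomology1997, II §4.4 Prop. 13] -/
theorem groupCdLE_two_ker_of_involution_moves {τ : absoluteGaloisGroup ℚ} (h2 : τ ^ 2 = 1) (hτ : ∃ m, ρ τ m ≠ m) :
    GroupCdLE ρ.ker 2 2 := by
  set L : IntermediateField ℚ (AlgebraicClosure ℚ) := IntermediateField.fixedField ρ.ker with hL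
  haveI : FiniteDimensional ℚ L := finiteDimensional_fixedField_of_isOpen ρ.ker (isOpen_ker ρ)
  haveI : NumberField L := NumberField.mk
  haveI : IsTotallyComplex L := isTotallyComplex_fixedField_ker ρ h2 hτ
  haveI : Fact (Nat.Prime 2) := ⟨Nat.prime_two⟩
  have hcd : FieldCdLE L 2 2 := fieldCdLE_two_of_numberField_holds L 2 (Or.inr inferInstance)
  -- `res(Γ_L) = N` as topological groups (equality of subgroups of `Γ_ℚ`)
  let e : (absGaloisRestrict ℚ L).range ≃ₜ* ρ.ker :=
    { MulEquiv.subgroupCongr (range_absGaloisRestrict_fixedField_ker ρ) with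
      continuous_toFun := continuous_subtype_val.subtype_mk _
      continuous_invFun := continuous_subtype_val.subtype_mk _ }
  exact (hcd.of_continuousMulEquiv (absGaloisRangeEquiv ℚ L)).of_continuousMulEquiv e

end Kernel

end Summit.BirchSwinnertonDyer.BirchSwinnertonDyer.Theorems.SignedEC.ArchMoves

end
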